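import Summits.AtomisticToContinuum.HydrodynamicLimit.Theorems.CollisionIsometryCLTAdaptedWeightCLTBlockHDissipation
import Literature.Analysis.FluidPDE.BoltzmannEquationProofs
import Literature.MathematicalPhysics.KineticTheory.HardSphereEulerProofs

/-!
# DV transfer for the line `block-h-dissipation-closure` (crux `AdaptedWeightCLT`, stmt-AtomisticToContinuum-14868),
# file 3: the chaos reference `chaosDens` is a positive probability density on `Quad`

Support file (`--supports stmt-AtomisticToContinuum-14868`, anchor `bhDVTransfer_chaos_anchor`) of the line lead
`prover-line-stmt-AtomisticToContinuum-14868-c4-0`, written for the registered stub `stub_dvTransfer` (S2): the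
normalisation facts about the line's vocabulary (`…Theorems.BlockHDissipation`) that the Donsker–Varadhan step
consumes on the space `Quad = V3⁴` of contact quadruples.

* `gauss`, `gauss4` (the mollifier `G_h`, `G_h^{⊗4}`): positivity, joint continuity, unit mass on `V3` / `Quad`
  (`integral_gauss4`), integrability — for `h ≠ 0`;
* cell weights and the pair flux: `cw ≥ 0`, `pairZ ≥ 0` for a nonnegative kernel family `ψ`; the sphere integral
  `∫ B((v, w), ω) dω` is finite and nonnegative (`integrable_hardSphereKernel_sphere`);
* `chaosDens`: `chaosDens ≥ 0`; the smeared pair term `y ↦ ∫ B(ω) G_h^{⊗4}(c(ω), y) dω` is continuous, integrable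
  and has mass `∫ B dω` (Fubini over `S² × Quad`, `integral_pairSmear`); hence for `pairZ ≠ 0` the chaos reference
  has unit mass (`integral_chaosDens`), and for `pairZ > 0` it is everywhere positive (`chaosDens_pos`) — the
  absolute continuity `contactDens ≪ chaosDens` needed by Donsker–Varadhan is automatic off the junk case
  `pairZ = 0` (no two cell atoms with distinct velocities at the window start).

No definitions; nothing about the dynamics is used (the configuration `w` is a parameter).
-/

namespace Summit.AtomisticToContinuum.HydrodynamicLimit.Theorems.BlockHDissipation

open scoped BigOperators Topology Classical MeasureTheory ENNReal InnerProductSpace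
open Filter Set MeasureTheory Real
open Literature.Analysis.FluidPDE
open Summit.AtomisticToContinuum.HydrodynamicLimit.Theorems.ContactSourceDuhamel (T3 V3 Cfg Vel Flow Flows)
open Literature.MathematicalPhysics.KineticTheory (collide hardSphereKernel sphereMeasure)

noncomputable section

namespace DVTransfer

/-! ## The mollifier `G_h` and `G_h^{⊗4}` -/

/-- `G_h(v − u) > 0` (`h ≠ 0`). -/
theorem gauss_pos {h : ℝ} (hh : h ≠ 0) (u v : V3) : 0 < gauss h u v :=
  Literature.MathematicalPhysics.KineticTheory.localMaxwellian_pos zero_lt_one (pow_pos (abs_pos.2 hh) 2 |>.trans_eq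
    (sq_abs h)) u v

/-- `G_h` is jointly continuous in (centre, point). -/
theorem continuous_gauss_uncurry (h : ℝ) : Continuous fun p : V3 × V3 => gauss h p.1 p.2 := by
  have e : (fun p : V3 × V3 => gauss h p.1 p.2) = fun p : V3 × V3 =>
      (1 * (2 * π * h ^ 2) ^ (-(Module.finrank ℝ V3 : ℝ) / 2)) * Real.exp (-‖p.2 - p.1‖ ^ 2 / (2 * h ^ 2)) := by
    funext p; rfl
  have hc : Continuous fun p : V3 × V3 => Real.exp (-‖p.2 - p.1‖ ^ 2 / (2 * h ^ 2)) := by fun_prop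
  rw [e]
  exact continuous_const.mul hc

/-- `G_h(· − u)` is continuous. -/
theorem continuous_gauss (h : ℝ) (u : V3) : Continuous (gauss h u) :=
  Literature.MathematicalPhysics.KineticTheory.continuous_localMaxwellian _ _ _

/-- `∫ G_h(v − u) dv = 1` (`h ≠ 0`). -/
theorem integral_gauss {h : ℝ} (hh : h ≠ 0) (u : V3) : ∫ v, gauss h u v = 1 :=
  Literature.MathematicalPhysics.KineticTheory.integral_localMaxwellian_one (pow_pos (abs_pos.2 hh) 2 |>.trans_eq
    (sq_abs h)) u

/-- `G_h(· − u)` is integrable (`h ≠ 0`). -/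
theorem integrable_gauss {h : ℝ} (hh : h ≠ 0) (u : V3) : Integrable (gauss h u) :=
  Literature.MathematicalPhysics.KineticTheory.integrable_localMaxwellian (pow_pos (abs_pos.2 hh) 2 |>.trans_eq
    (sq_abs h)) u

/-- `G_h^{⊗4} > 0` (`h ≠ 0`). -/
theorem gauss4_pos {h : ℝ} (hh : h ≠ 0) (c y : Quad) : 0 < gauss4 h c y :=
  mul_pos (mul_pos (mul_pos (gauss_pos hh _ _) (gauss_pos hh _ _)) (gauss_pos hh _ _)) (gauss_pos hh _ _)

/-- `G_h^{⊗4}` is jointly continuous in (centre, point). -/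
theorem continuous_gauss4_uncurry (h : ℝ) : Continuous fun p : Quad × Quad => gauss4 h p.1 p.2 := by
  have hg := continuous_gauss_uncurry h
  have h1 : Continuous fun p : Quad × Quad => gauss h p.1.1 p.2.1 :=
    hg.comp (f := fun p : Quad × Quad => (p.1.1, p.2.1)) (by fun_prop)
  have h2 : Continuous fun p : Quad × Quad => gauss h p.1.2.1 p.2.2.1 :=
    hg.comp (f := fun p : Quad × Quad => (p.1.2.1, p.2.2.1)) (by fun_prop)
  have h3 : Continuous fun p : Quad × Quad => gauss h p.1.2.2.1 p.2.2.2.1 :=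
    hg.comp (f := fun p : Quad × Quad => (p.1.2.2.1, p.2.2.2.1)) (by fun_prop)
  have h4 : Continuous fun p : Quad × Quad => gauss h p.1.2.2.2 p.2.2.2.2 :=
    hg.comp (f := fun p : Quad × Quad => (p.1.2.2.2, p.2.2.2.2)) (by fun_prop)
  unfold gauss4
  exact ((h1.mul h2).mul h3).mul h4

/-- `G_h^{⊗4}(· − c)` is continuous. -/
theorem continuous_gauss4 (h : ℝ) (c : Quad) : Continuous (gauss4 h c) :=
  (continuous_gauss4_uncurry h).comp (f := fun y : Quad => (c, y)) (by fun_prop)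

/-- `G_h^{⊗4}` as a product over the splitting `Quad = V3 × (V3 × (V3 × V3))`. -/
theorem gauss4_eq (h : ℝ) (c y : Quad) :
    gauss4 h c y = gauss h c.1 y.1 * (gauss h c.2.1 y.2.1 * (gauss h c.2.2.1 y.2.2.1 * gauss h c.2.2.2 y.2.2.2)) := by
  unfold gauss4; ring

/-- `G_h^{⊗4}(· − c)` is integrable on `Quad` (`h ≠ 0`). -/
theorem integrable_gauss4 {h : ℝ} (hh : h ≠ 0) (c : Quad) : Integrable (gauss4 h c) := by
  have e : gauss4 h c = fun y : Quad =>
      gauss h c.1 y.1 * (gauss h c.2.1 y.2.1 * (gauss h c.2.2.1 y.2.2.1 * gauss h c.2.2.2 y.2.2.2)) :=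
    funext fun y => gauss4_eq h c y
  rw [e]
  have i4 : Integrable (fun y : V3 × V3 => gauss h c.2.2.1 y.1 * gauss h c.2.2.2 y.2)
      ((volume : Measure V3).prod volume) :=
    (integrable_gauss hh c.2.2.1).mul_prod (integrable_gauss hh c.2.2.2)
  have i3 : Integrable (fun y : V3 × V3 × V3 => gauss h c.2.1 y.1 * (gauss h c.2.2.1 y.2.1 * gauss h c.2.2.2 y.2.2))
      ((volume : Measure V3).prod ((volume : Measure V3).prod volume)) :=
    (integrable_gauss hh c.2.1).mul_prod i4
  exact (integrable_gauss hh c.1).mul_prod i3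

/-- `∫_{Quad} G_h^{⊗4}(y − c) dy = 1` (`h ≠ 0`). -/
theorem integral_gauss4 {h : ℝ} (hh : h ≠ 0) (c : Quad) : ∫ y, gauss4 h c y = 1 := by
  have e : gauss4 h c = fun y : Quad =>
      gauss h c.1 y.1 * (gauss h c.2.1 y.2.1 * (gauss h c.2.2.1 y.2.2.1 * gauss h c.2.2.2 y.2.2.2)) :=
    funext fun y => gauss4_eq h c y
  rw [e]
  have h4 : ∫ y : V3 × V3, gauss h c.2.2.1 y.1 * gauss h c.2.2.2 y.2 = 1 := by
    rw [show (volume : Measure (V3 × V3)) = (volume : Measure V3).prod volume from rfl,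
      integral_prod_mul (gauss h c.2.2.1) (gauss h c.2.2.2), integral_gauss hh, integral_gauss hh, mul_one]
  have h3 : ∫ y : V3 × V3 × V3, gauss h c.2.1 y.1 * (gauss h c.2.2.1 y.2.1 * gauss h c.2.2.2 y.2.2) = 1 := by
    rw [show (volume : Measure (V3 × V3 × V3)) = (volume : Measure V3).prod volume from rfl,
      integral_prod_mul (gauss h c.2.1) (fun y : V3 × V3 => gauss h c.2.2.1 y.1 * gauss h c.2.2.2 y.2),
      integral_gauss hh, h4, mul_one]
  rw [show (volume : Measure Quad) = (volume : Measure V3).prod volume from rfl,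
    integral_prod_mul (gauss h c.1)
      (fun y : V3 × V3 × V3 => gauss h c.2.1 y.1 * (gauss h c.2.2.1 y.2.1 * gauss h c.2.2.2 y.2.2)),
    integral_gauss hh, h3, mul_one]

/-! ## Cell weights and the pair flux -/

/-- Cell weights are nonnegative for a nonnegative kernel family. -/
theorem cw_nonneg {ψ : ℕ → T3 → ℝ} (hψ : ∀ N y, 0 ≤ ψ N y) (N : ℕ) (w : Cfg N) (x : T3) (i : Fin (N + 1)) :
    0 ≤ cw N ψ w x i :=
  hψ N _

/-- The hard-sphere kernel is bounded by the relative speed: `((v − w)·ω)_+ ≤ ‖v − w‖`. -/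
theorem hardSphereKernel_le_norm (p : V3 × V3) (ω : Metric.sphere (0 : V3) 1) :
    hardSphereKernel p ω ≤ ‖p.1 - p.2‖ := by
  unfold hardSphereKernel
  refine max_le ?_ (norm_nonneg _)
  calc ⟪p.1 - p.2, (ω : V3)⟫_ℝ ≤ ‖p.1 - p.2‖ * ‖(ω : V3)‖ := real_inner_le_norm _ _
    _ = ‖p.1 - p.2‖ := by rw [norm_eq_of_mem_sphere ω, mul_one]

/-- The hard-sphere kernel is continuous in the direction. -/
theorem continuous_hardSphereKernel_dir (p : V3 × V3) : Continuous fun ω : Metric.sphere (0 : V3) 1 =>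
    hardSphereKernel p ω := by
  unfold hardSphereKernel
  fun_prop

/-- `ω ↦ B((v, w), ω)` is integrable on the sphere (bounded and continuous on a finite measure). -/
theorem integrable_hardSphereKernel_sphere (p : V3 × V3) :
    Integrable (fun ω : Metric.sphere (0 : V3) 1 => hardSphereKernel p ω) sphereMeasure := by
  haveI := isFiniteMeasure_sphereMeasure (E := V3)
  refine Integrable.of_bound (continuous_hardSphereKernel_dir p).aestronglyMeasurable (‖p.1 - p.2‖)
    (Eventually.of_forall fun ω => ?_)
  rw [Real.norm_eq_abs, abs_of_nonneg (le_max_right _ _)]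
  exact hardSphereKernel_le_norm p ω

/-- `0 ≤ ∫ B((v, w), ω) dω`. -/
theorem integral_hardSphereKernel_sphere_nonneg (p : V3 × V3) :
    0 ≤ ∫ ω, hardSphereKernel p ω ∂sphereMeasure :=
  integral_nonneg fun _ => le_max_right _ _

/-- The pair flux of the atomic cell law is nonnegative (nonnegative kernel family). -/
theorem pairZ_nonneg {ψ : ℕ → T3 → ℝ} (hψ : ∀ N y, 0 ≤ ψ N y) (N : ℕ) (w : Cfg N) (x : T3) :
    0 ≤ pairZ N ψ w x := by
  unfold pairZ
  refine Finset.sum_nonneg fun l _ => Finset.sum_nonneg fun l' _ => ?_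
  exact mul_nonneg (mul_nonneg (cw_nonneg hψ N w x l) (cw_nonneg hψ N w x l'))
    (integral_hardSphereKernel_sphere_nonneg _)

/-! ## The smeared pair term and the chaos reference -/

/-- The post-collisional quadruple of the pair `(v, w)` with direction `ω`: `(v, w, v′, w′)`. -/
theorem continuous_pairQuad (p : V3 × V3) : Continuous fun ω : Metric.sphere (0 : V3) 1 =>
    ((p.1, p.2, (collide ω p).1, (collide ω p).2) : Quad) := by
  have hc : Continuous fun ω : Metric.sphere (0 : V3) 1 => collide ω p :=
    continuous_collide_uncurry.comp (Continuous.prodMk_right p)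
  fun_prop

/-- The integrand `(ω, y) ↦ B((v,w), ω) G_h^{⊗4}((v, w, v′, w′), y)` of the smeared pair term is jointly
continuous. -/
theorem continuous_pairSmearIntegrand (h : ℝ) (p : V3 × V3) :
    Continuous fun q : Metric.sphere (0 : V3) 1 × Quad =>
      hardSphereKernel p q.1 * gauss4 h (p.1, p.2, (collide q.1 p).1, (collide q.1 p).2) q.2 := by
  refine ((continuous_hardSphereKernel_dir p).comp (f := fun q : Metric.sphere (0 : V3) 1 × Quad => q.1)
    continuous_fst).mul ?_
  exact (continuous_gauss4_uncurry h).comp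
    (f := fun q : Metric.sphere (0 : V3) 1 × Quad => (((p.1, p.2, (collide q.1 p).1, (collide q.1 p).2) : Quad), q.2))
    (((continuous_pairQuad p).comp (f := fun q : Metric.sphere (0 : V3) 1 × Quad => q.1) continuous_fst).prodMk
      continuous_snd)

/-- The smeared pair integrand is integrable on `S² × Quad` (`h ≠ 0`): fibrewise `B(ω) · G^{⊗4}` has mass `B(ω)`,
which is integrable on the sphere. -/
theorem integrable_pairSmearIntegrand {h : ℝ} (hh : h ≠ 0) (p : V3 × V3) :
    Integrable (fun q : Metric.sphere (0 : V3) 1 × Quad =>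
      hardSphereKernel p q.1 * gauss4 h (p.1, p.2, (collide q.1 p).1, (collide q.1 p).2) q.2)
      ((sphereMeasure : Measure (Metric.sphere (0 : V3) 1)).prod volume) := by
  haveI := isFiniteMeasure_sphereMeasure (E := V3)
  refine (integrable_prod_iff (continuous_pairSmearIntegrand h p).aestronglyMeasurable).2 ⟨?_, ?_⟩
  · refine Eventually.of_forall fun ω => ?_
    exact (integrable_gauss4 hh (p.1, p.2, (collide ω p).1, (collide ω p).2)).const_mul (hardSphereKernel p ω)
  · have e : (fun ω : Metric.sphere (0 : V3) 1 => ∫ y : Quad,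
        ‖hardSphereKernel p ω * gauss4 h (p.1, p.2, (collide ω p).1, (collide ω p).2) y‖) =
        fun ω => hardSphereKernel p ω := by
      funext ω
      have hB : 0 ≤ hardSphereKernel p ω := le_max_right _ _
      have : (fun y : Quad => ‖hardSphereKernel p ω * gauss4 h (p.1, p.2, (collide ω p).1, (collide ω p).2) y‖) =
          fun y => hardSphereKernel p ω * gauss4 h (p.1, p.2, (collide ω p).1, (collide ω p).2) y := by
        funext y
        rw [Real.norm_eq_abs, abs_of_nonneg (mul_nonneg hB (gauss4_pos hh _ _).le)]
      rw [this, integral_const_mul, integral_gauss4 hh, mul_one]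
    rw [e]
    exact integrable_hardSphereKernel_sphere p

/-- **Mass of the smeared pair term**: `∫_{Quad} ∫_{S²} B(ω) G_h^{⊗4}((v,w,v′,w′), y) dω dy = ∫_{S²} B(ω) dω`
(`h ≠ 0`; Fubini). -/
theorem integral_pairSmear {h : ℝ} (hh : h ≠ 0) (p : V3 × V3) :
    ∫ y : Quad, ∫ ω, hardSphereKernel p ω * gauss4 h (p.1, p.2, (collide ω p).1, (collide ω p).2) y ∂sphereMeasure =
      ∫ ω, hardSphereKernel p ω ∂sphereMeasure := by
  haveI := isFiniteMeasure_sphereMeasure (E := V3)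
  have hsw := integral_integral_swap (μ := (sphereMeasure : Measure (Metric.sphere (0 : V3) 1)))
    (ν := (volume : Measure Quad))
    (f := fun (ω : Metric.sphere (0 : V3) 1) (y : Quad) =>
      hardSphereKernel p ω * gauss4 h (p.1, p.2, (collide ω p).1, (collide ω p).2) y)
    (integrable_pairSmearIntegrand hh p)
  rw [← hsw]
  refine integral_congr_ae (Eventually.of_forall fun ω => ?_)
  simp only
  rw [integral_const_mul, integral_gauss4 hh, mul_one]

/-- The smeared pair term `y ↦ ∫ B(ω) G_h^{⊗4}(c(ω), y) dω` is integrable on `Quad` (`h ≠ 0`). -/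
theorem integrable_pairSmear {h : ℝ} (hh : h ≠ 0) (p : V3 × V3) :
    Integrable (fun y : Quad => ∫ ω, hardSphereKernel p ω *
      gauss4 h (p.1, p.2, (collide ω p).1, (collide ω p).2) y ∂sphereMeasure) := by
  haveI := isFiniteMeasure_sphereMeasure (E := V3)
  exact (integrable_pairSmearIntegrand hh p).integral_prod_right

/-- The smeared pair term is nonnegative. -/
theorem pairSmear_nonneg {h : ℝ} (hh : h ≠ 0) (p : V3 × V3) (y : Quad) :
    0 ≤ ∫ ω, hardSphereKernel p ω * gauss4 h (p.1, p.2, (collide ω p).1, (collide ω p).2) y ∂sphereMeasure :=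
  integral_nonneg fun _ => mul_nonneg (le_max_right _ _) (gauss4_pos hh _ _).le

/-- The `ω`-fibre of the smeared pair integrand at fixed `y` is integrable on the sphere (continuous on a compact
space, finite measure). -/
theorem integrable_pairSmear_fibre (h : ℝ) (p : V3 × V3) (y : Quad) :
    Integrable (fun ω : Metric.sphere (0 : V3) 1 =>
      hardSphereKernel p ω * gauss4 h (p.1, p.2, (collide ω p).1, (collide ω p).2) y) sphereMeasure := by
  haveI := isFiniteMeasure_sphereMeasure (E := V3)
  have hcont : Continuous fun ω : Metric.sphere (0 : V3) 1 =>
      hardSphereKernel p ω * gauss4 h (p.1, p.2, (collide ω p).1, (collide ω p).2) y :=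
    (continuous_pairSmearIntegrand h p).comp (f := fun ω : Metric.sphere (0 : V3) 1 => (ω, y)) (by fun_prop)
  have hK : IntegrableOn (fun ω : Metric.sphere (0 : V3) 1 =>
      hardSphereKernel p ω * gauss4 h (p.1, p.2, (collide ω p).1, (collide ω p).2) y) Set.univ sphereMeasure :=
    hcont.continuousOn.integrableOn_compact isCompact_univ
  rwa [integrableOn_univ] at hK

/-- The smeared pair term is positive at every `y` as soon as the pair has positive flux `∫ B dω > 0`
(`h ≠ 0`). -/
theorem pairSmear_pos {h : ℝ} (hh : h ≠ 0) (p : V3 × V3) (hp : 0 < ∫ ω, hardSphereKernel p ω ∂sphereMeasure)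
    (y : Quad) :
    0 < ∫ ω, hardSphereKernel p ω * gauss4 h (p.1, p.2, (collide ω p).1, (collide ω p).2) y ∂sphereMeasure := by
  have hB0 : ∀ ω : Metric.sphere (0 : V3) 1, 0 ≤ hardSphereKernel p ω := fun ω => le_max_right _ _
  have hsupp0 := (integral_pos_iff_support_of_nonneg hB0 (integrable_hardSphereKernel_sphere p)).1 hp
  refine (integral_pos_iff_support_of_nonneg (fun ω => mul_nonneg (hB0 ω) (gauss4_pos hh _ _).le)
    (integrable_pairSmear_fibre h p y)).2 ?_
  have hs : (Function.support fun ω : Metric.sphere (0 : V3) 1 =>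
      hardSphereKernel p ω * gauss4 h (p.1, p.2, (collide ω p).1, (collide ω p).2) y) =
      Function.support fun ω : Metric.sphere (0 : V3) 1 => hardSphereKernel p ω := by
    ext ω
    simp only [Function.mem_support, ne_eq, mul_eq_zero, not_or, and_iff_left_iff_imp]
    exact fun _ => (gauss4_pos hh _ _).ne'
  rw [hs]
  exact hsupp0

/-- The chaos reference is nonnegative (nonnegative kernel family, `h ≠ 0`). -/
theorem chaosDens_nonneg {ψ : ℕ → T3 → ℝ} (hψ : ∀ N y, 0 ≤ ψ N y) {h : ℝ} (hh : h ≠ 0) (N : ℕ) (w : Cfg N)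
    (x : T3) (y : Quad) : 0 ≤ chaosDens N ψ h w x y := by
  unfold chaosDens
  refine mul_nonneg (inv_nonneg.2 (pairZ_nonneg hψ N w x)) (Finset.sum_nonneg fun l _ =>
    Finset.sum_nonneg fun l' _ => ?_)
  exact mul_nonneg (mul_nonneg (cw_nonneg hψ N w x l) (cw_nonneg hψ N w x l')) (pairSmear_nonneg hh _ _)

/-- **Unit mass of the chaos reference**: `∫_{Quad} chaosDens dy = 1` whenever `pairZ ≠ 0` (`h ≠ 0`). -/
theorem integral_chaosDens {ψ : ℕ → T3 → ℝ} {h : ℝ} (hh : h ≠ 0) (N : ℕ) (w : Cfg N) (x : T3)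
    (hZ : pairZ N ψ w x ≠ 0) : ∫ y, chaosDens N ψ h w x y = 1 := by
  unfold chaosDens
  rw [integral_const_mul, integral_finsetSum _ (fun l _ => ?_)]
  · have e : ∀ l : Fin (N + 1), ∫ y : Quad, ∑ l', cw N ψ w x l * cw N ψ w x l' *
        ∫ ω, hardSphereKernel ((w l).2, (w l').2) ω *
          gauss4 h ((w l).2, (w l').2, (collide ω ((w l).2, (w l').2)).1, (collide ω ((w l).2, (w l').2)).2) y
          ∂sphereMeasure =
        ∑ l', cw N ψ w x l * cw N ψ w x l' * ∫ ω, hardSphereKernel ((w l).2, (w l').2) ω ∂sphereMeasure := by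
      intro l
      rw [integral_finsetSum _ (fun l' _ => ((integrable_pairSmear hh ((w l).2, (w l').2)).const_mul _))]
      refine Finset.sum_congr rfl fun l' _ => ?_
      rw [integral_const_mul, integral_pairSmear hh ((w l).2, (w l').2)]
    simp_rw [e]
    rw [← pairZ, inv_mul_cancel₀ hZ]
  · exact integrable_finsetSum _ fun l' _ => (integrable_pairSmear hh ((w l).2, (w l').2)).const_mul _

/-- The chaos reference is integrable on `Quad` (`h ≠ 0`). -/
theorem integrable_chaosDens (ψ : ℕ → T3 → ℝ) {h : ℝ} (hh : h ≠ 0) (N : ℕ) (w : Cfg N) (x : T3) :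
    Integrable (chaosDens N ψ h w x) := by
  unfold chaosDens
  refine Integrable.const_mul (integrable_finsetSum _ fun l _ => integrable_finsetSum _ fun l' _ => ?_) _
  exact (integrable_pairSmear hh ((w l).2, (w l').2)).const_mul _

/-- The chaos reference is continuous on `Quad` (`h ≠ 0`; continuity of the parametric sphere integrals by
dominated convergence is replaced by the elementary route: each smeared pair term is continuous as the integral
of a jointly continuous integrand over a compact fibre). -/
theorem measurable_chaosDens (ψ : ℕ → T3 → ℝ) {h : ℝ} (hh : h ≠ 0) (N : ℕ) (w : Cfg N) (x : T3) :
    AEStronglyMeasurable (chaosDens N ψ h w x) volume :=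
  (integrable_chaosDens ψ hh N w x).aestronglyMeasurable

/-- **Positivity of the chaos reference**: if `pairZ > 0` (two cell atoms of positive weight with positive pair
flux at the window start), then `chaosDens > 0` everywhere on `Quad` (`h ≠ 0`, nonnegative kernel family). -/
theorem chaosDens_pos {ψ : ℕ → T3 → ℝ} (hψ : ∀ N y, 0 ≤ ψ N y) {h : ℝ} (hh : h ≠ 0) (N : ℕ) (w : Cfg N)
    (x : T3) (hZ : 0 < pairZ N ψ w x) (y : Quad) : 0 < chaosDens N ψ h w x y := by
  -- a pair `(l, l')` with positive weight-and-flux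
  obtain ⟨l, -, hl⟩ : ∃ l ∈ (Finset.univ : Finset (Fin (N + 1))), 0 < ∑ l', cw N ψ w x l * cw N ψ w x l' *
      ∫ ω, hardSphereKernel ((w l).2, (w l').2) ω ∂sphereMeasure := by
    by_contra hcon
    push Not at hcon
    have : pairZ N ψ w x ≤ 0 := Finset.sum_nonpos fun l hl => hcon l hl
    exact absurd hZ (not_lt.2 this)
  obtain ⟨l', -, hl'⟩ : ∃ l' ∈ (Finset.univ : Finset (Fin (N + 1))), 0 < cw N ψ w x l * cw N ψ w x l' *
      ∫ ω, hardSphereKernel ((w l).2, (w l').2) ω ∂sphereMeasure := by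
    by_contra hcon
    push Not at hcon
    have : ∑ l', cw N ψ w x l * cw N ψ w x l' * ∫ ω, hardSphereKernel ((w l).2, (w l').2) ω ∂sphereMeasure ≤ 0 :=
      Finset.sum_nonpos fun l' hl' => hcon l' hl'
    exact absurd hl (not_lt.2 this)
  have hcc : 0 < cw N ψ w x l * cw N ψ w x l' := by
    rcases (mul_nonneg (cw_nonneg hψ N w x l) (cw_nonneg hψ N w x l')).eq_or_lt with h0 | h0
    · rw [← h0, zero_mul] at hl'; exact absurd hl' (lt_irrefl _)
    · exact h0
  have hflux : 0 < ∫ ω, hardSphereKernel ((w l).2, (w l').2) ω ∂sphereMeasure := by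
    by_contra hcon
    push Not at hcon
    exact absurd hl' (not_lt.2 (mul_nonpos_of_nonneg_of_nonpos hcc.le hcon))
  unfold chaosDens
  refine mul_pos (inv_pos.2 hZ) ?_
  refine lt_of_lt_of_le (mul_pos hcc (pairSmear_pos hh ((w l).2, (w l').2) hflux y)) ?_
  refine le_trans ?_ (Finset.single_le_sum (f := fun l => ∑ l', cw N ψ w x l * cw N ψ w x l' *
      ∫ ω, hardSphereKernel ((w l).2, (w l').2) ω *
        gauss4 h ((w l).2, (w l').2, (collide ω ((w l).2, (w l').2)).1, (collide ω ((w l).2, (w l').2)).2) y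
        ∂sphereMeasure) (fun l _ => Finset.sum_nonneg fun l' _ =>
        mul_nonneg (mul_nonneg (cw_nonneg hψ N w x l) (cw_nonneg hψ N w x l')) (pairSmear_nonneg hh _ _))
      (Finset.mem_univ l))
  exact Finset.single_le_sum (f := fun l' => cw N ψ w x l * cw N ψ w x l' *
      ∫ ω, hardSphereKernel ((w l).2, (w l').2) ω *
        gauss4 h ((w l).2, (w l').2, (collide ω ((w l).2, (w l').2)).1, (collide ω ((w l).2, (w l').2)).2) y
        ∂sphereMeasure)
    (fun l' _ => mul_nonneg (mul_nonneg (cw_nonneg hψ N w x l) (cw_nonneg hψ N w x l')) (pairSmear_nonneg hh _ _))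
    (Finset.mem_univ l')

end DVTransfer

/-! ## Registered anchor of this support file -/

/-- ANCHOR (registered helper stub `bhDVTransfer_chaos_anchor` of the crux item): for a nonnegative kernel family,
`h ≠ 0` and a configuration whose atomic cell law at `x` has positive pair flux `pairZ > 0`, the chaos reference
`chaosDens` is a probability density on `Quad` which is everywhere positive. -/
theorem bhDVTransfer_chaos_anchor : ∀ (ψ : ℕ → T3 → ℝ), (∀ N y, 0 ≤ ψ N y) → ∀ (h : ℝ), h ≠ 0 → ∀ (N : ℕ) (w : Cfg N) (x : T3), 0 < pairZ N ψ w x → (∫ y, chaosDens N ψ h w x y = 1) ∧ ∀ y : Quad, 0 < chaosDens N ψ h w x y :=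
  fun _ hψ _ hh N w x hZ => ⟨DVTransfer.integral_chaosDens hh N w x hZ.ne', DVTransfer.chaosDens_pos hψ hh N w x hZ⟩

end

end Summit.AtomisticToContinuum.HydrodynamicLimit.Theorems.BlockHDissipation
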